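import Literature.NumberTheory.Automorphic.GLnLeviSmoothTransport             -- ★ (A1) riders: `isLocallyConstant_normAbs_det_boxAd_levi`, `continuous_standardLeviGL_inclusion`
import Literature.NumberTheory.Automorphic.GLnTwoBlockBoxAdLIntegral           -- ★ D-S1c: `det_boxAd_conj_eq` (`det K_{y m y⁻¹} = det K_m`)
import Literature.NumberTheory.Automorphic.HeckeCharacterLocalComponentSmooth  -- ★ `HeckeCharacter.isOpen_ker_localComponent`
import HarnessLib

/-!
# The split-place transfer weight `ψ(m) = C · χ(m) · ‖det K_m‖^{1∕2}` on a two-block Levi `M_c ⊂ GL_n(F)` is a locally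
# constant class function of `M_c`

Topic `NumberTheory/Automorphic`; namespace `Literature.NumberTheory.Automorphic` (§1–§4) with the Hecke reading of §1 as a
dot-notation extension of `Literature.NumberTheory.GaloisRepresentations.HeckeCharacter`.  THEOREMS ONLY (no definition, no named
fact, no instance, no notation, no `sorry`).  Cell `pub/hodgecm-mathlib`, F0∕P3a, road «D-N6s» (letter N6 = the local endoscopic
transfer `φ ↦ φ^H` of [Rogawski1990, Prop. 4.9.1 (a)] at a place split in `L`), brick «B5-A ψ-RIDERS» (LEAD F0P3a-plan (g8) WORD
T7-73; consumer: the assembly B5-A PART 2 (b), B-p12 (g27)).  HC_CM is proved only modulo the printed citations until rung 0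
closes; nothing printed is asserted here.

THE MATHEMATICS.  At a split place the transfer to `H = U(2) × U(1) ≅ M = GL₂ × GL₁ ⊂ GL₃` is `φ^H = ψ · φ^{(P)}|_M` with the
multiplier `ψ(m) = C · τ(m) · δ_P(m)^{1∕2}`, where `τ = μ ∘ det` is a character of the `GL₂`-block [Rogawski1990, §4.9 p. 55: «if `v`
splits, `τ` is the character `μ ∘ det` of `M`»] and `δ_P(m) = ‖det K_m‖_F` is the modulus of `P` (`K_m = Ad(m)|_𝔫`, the box of ★
`GLnTwoBlockBoxAdLIntegral`) [Rogawski1990, §4.13 Lemma 4.13.1 (a) p. 64].  The two facts the assembly of (4.3.1) needs about `ψ` are: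
(i) `ψ` is a CLASS FUNCTION of `M` — `det` of a block and `det K_m` are invariant under `M`-conjugation (a homomorphism into a
commutative group kills conjugation; `det K_{y m y⁻¹} = det K_m` is ★ `det_boxAd_conj_eq`); (ii) `ψ` is LOCALLY CONSTANT — a
quasi-character of `F^×` with open kernel (every continuous one: [BushnellHenniart2006, §1.5]; for Hecke local components ★
`HeckeCharacter.isOpen_ker_localComponent`) is locally constant, `det` of a block is continuous, and `m ↦ ‖det K_m‖_F` is locally
constant (★ `isLocallyConstant_normAbs_det_boxAd_levi`).

* §1 `isLocallyConstant_of_isOpen_ker` — a homomorphism of a topological group with open kernel is locally constant; the Hecke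
  readings `HeckeCharacter.isLocallyConstant_localComponent` ∕ `…_coe` (`u ↦ ω_v(u)` on `K_vˣ`, `ℂˣ`- and `ℂ`-valued).
* §2 `map_conj_eq_of_commGroup` — `d(y m y⁻¹) = d(m)` for a homomorphism `d` into a commutative group.
* §3 (index-generic `n`, two-block labelling `c : n → Bool`, `F` a non-archimedean local field; the box of `m ∈ M_c` READ IN `P_c` through
  `⟨↑m, standardLeviGL_le F c m.2⟩`, the spelling of ★ `isLocallyConstant_normAbs_det_boxAd_levi`): `inclusion_levi_conj` (bookkeeping),
  **`det_boxAd_levi_conj_eq`**, `normAbs_det_boxAd_levi_conj_eq` (`‖det K_{y m y⁻¹}‖ = ‖det K_m‖`); the intrinsic blocks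
  `leviProjection F c ⟨↑m, _⟩ b`: `det_leviProjection_levi_conj_eq`, `continuous_det_leviProjection_levi`,
  `isLocallyConstant_comp_det_leviProjection_levi`; the model blocks `(e.symm m).1`, `(e.symm m).2` for ANY `e : GL_k × GL_l ≃* M_c`
  (★ `exists_continuousMulEquiv_prod_standardLeviGL_twoBlock`): `det_fst_symm_conj_eq`, `det_snd_symm_conj_eq`,
  `isLocallyConstant_comp_det_fst_symm`; and the junction `leviEmbeddingP_leviProjection_levi` (`⟨↑m, _⟩ = leviEmbeddingP (blocks of m)`,
  so that the `K_p` of ★ `finExplicitDelta_mul_toReal_eq_of_split` at `p := leviEmbeddingP F c (leviProjection F c ⟨↑m, _⟩)` IS `K_m`).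
* §4 THE HEADS the assembly consumes, for `ψ m := C * χM m * ↑(√‖det K_m‖_F)` with `χM : M_c → ℂ`:
  **`levi_weight_conj_eq`** (`∀ y, ψ (y * m₀ * y⁻¹) = ψ m₀` from `χM (y m₀ y⁻¹) = χM m₀`) — the `hψ` of ★ B5-L
  `classOrbitalIntegral_eq_mul_orbitalIntegral_of_isCanonical_of_eq`; **`isLocallyConstant_levi_weight`** (from `IsLocallyConstant χM`) —
  the `hψ` of ★ (A1) `isLocSmooth_mul_constantTerm_comp_twoOne`; and the two concrete `χM`: `χ ∘ det ∘ (leviProjection · b₀)`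
  (`levi_weight_det_leviProjection_conj_eq`, `isLocallyConstant_levi_weight_det_leviProjection`) and `χ ∘ det ∘ Prod.fst ∘ e.symm`
  (`levi_weight_det_fst_symm_conj_eq`, `isLocallyConstant_levi_weight_det_fst_symm`), `χ : Fˣ → ℂ` locally constant
  (for `χ := (μ_w)_ℂ` this is §1).

## References
* [Rogawski1990] J. D. Rogawski, *Automorphic Representations of Unitary Groups in Three Variables*, Ann. of Math. Stud. 123 (1990),
  §4.9 Prop. 4.9.1 (a) and p. 55 (`τ = μ ∘ det` at a split place); §4.13 Lemma 4.13.1 (a) p. 64 (`δ_P`, the descent to `M`).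
* [BushnellHenniart2006] C. J. Bushnell, G. Henniart, *The Local Langlands Conjecture for GL(2)*, Grundlehren 335 (2006), §1.5
  (characters of `F^×` with open kernel), §1.1 (locally constant functions).
* [BernsteinZelevinsky1977] I. N. Bernstein, A. V. Zelevinsky, *Induced representations of reductive `p`-adic groups I*, Ann. Sci.
  ÉNS 10 (1977), §2.1 (`M_c ≅ Π GL_{n_a}`, the blocks), §2.3 (the modulus).
* [TateThesis1967] J. Tate, *Fourier analysis in number fields and Hecke's zeta-functions* (1967), §2.1, §4.3 (local components).
-/

set_option autoImplicit false

noncomputable section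

open scoped MatrixGroups NNReal
open Matrix Topology Filter

namespace Literature.NumberTheory.Automorphic

open Literature.NumberTheory.GaloisRepresentations.IsNonarchimedeanLocalField

/-! ## §1 A homomorphism with open kernel is locally constant -/

section OpenKer

variable {G T : Type*} [Group G] [TopologicalSpace G] [ContinuousMul G] [Group T]

/-- **A homomorphism with open kernel is locally constant**: `f` is constant on the open coset `x · ker f` of every `x`
(the smooth characters of a locally profinite group are exactly those with open kernel). [cite: BushnellHenniart2006, §1.5; §1.1] -/
theorem isLocallyConstant_of_isOpen_ker (f : G →* T) (hf : IsOpen ((f.ker : Subgroup G) : Set G)) :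
    IsLocallyConstant f := by
  refine (IsLocallyConstant.iff_eventually_eq f).2 fun x => ?_
  have hx : IsOpen ((fun y : G => x⁻¹ * y) ⁻¹' ((f.ker : Subgroup G) : Set G)) :=
    hf.preimage (continuous_const.mul continuous_id)
  have hmem : x ∈ (fun y : G => x⁻¹ * y) ⁻¹' ((f.ker : Subgroup G) : Set G) := by
    rw [Set.mem_preimage, SetLike.mem_coe, MonoidHom.mem_ker, inv_mul_cancel, map_one]
  filter_upwards [hx.mem_nhds hmem] with y hy
  rw [Set.mem_preimage, SetLike.mem_coe, MonoidHom.mem_ker, map_mul, map_inv, inv_mul_eq_one] at hy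
  exact hy.symm

/-- A `Tˣ`-valued homomorphism with open kernel is locally constant as a `T`-valued function. [cite: BushnellHenniart2006, §1.5; §1.1] -/
theorem isLocallyConstant_coe_of_isOpen_ker {S : Type*} [Monoid S] (f : G →* Sˣ)
    (hf : IsOpen ((f.ker : Subgroup G) : Set G)) : IsLocallyConstant fun x => ((f x : Sˣ) : S) :=
  (isLocallyConstant_of_isOpen_ker f hf).comp Units.val

end OpenKer

end Literature.NumberTheory.Automorphic

namespace Literature.NumberTheory.GaloisRepresentations.HeckeCharacter

open NumberField IsDedekindDomain

variable {K : Type} [Field K] [NumberField K]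

/-- **Local components of Hecke characters are locally constant** (`ℂˣ`-valued): `ker ω_v` is open (★ `isOpen_ker_localComponent`),
so `ω_v` is constant on cosets of an open subgroup.  (Dot-notation extension of `HeckeCharacter`, which lives in
`GaloisRepresentations/`, declared from `Automorphic/` next to ★ `isOpen_ker_localComponent`.) [cite: TateThesis1967, §4.3] [cite: BushnellHenniart2006, §1.5] -/
theorem isLocallyConstant_localComponent (ω : HeckeCharacter K) (v : HeightOneSpectrum (𝓞 K)) :
    IsLocallyConstant (ω.localComponent v) :=
  Literature.NumberTheory.Automorphic.isLocallyConstant_of_isOpen_ker _ (ω.isOpen_ker_localComponent v)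

/-- **Local components of Hecke characters are locally constant** (`ℂ`-valued reading `u ↦ (ω_v u : ℂ)`, the currency of the transfer
weight `χ := μ_w ∘ det`). [cite: TateThesis1967, §4.3] [cite: BushnellHenniart2006, §1.5] -/
theorem isLocallyConstant_localComponent_coe (ω : HeckeCharacter K) (v : HeightOneSpectrum (𝓞 K)) :
    IsLocallyConstant fun u : (v.adicCompletion K)ˣ => ((ω.localComponent v u : ℂˣ) : ℂ) :=
  Literature.NumberTheory.Automorphic.isLocallyConstant_coe_of_isOpen_ker _ (ω.isOpen_ker_localComponent v)

end Literature.NumberTheory.GaloisRepresentations.HeckeCharacter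

namespace Literature.NumberTheory.Automorphic

open Literature.NumberTheory.GaloisRepresentations.IsNonarchimedeanLocalField

/-! ## §2 A homomorphism into a commutative group is a class function -/

section ConjHom

variable {M T : Type*} [Group M] [CommGroup T]

/-- **`d(y m y⁻¹) = d(m)`** for a homomorphism `d : M →* T` into a commutative group (e.g. `det` of a diagonal block of a Levi
subgroup, valued in `Fˣ`). [cite: BernsteinZelevinsky1977, §2.1] -/
theorem map_conj_eq_of_commGroup (d : M →* T) (y m : M) : d (y * m * y⁻¹) = d m := by
  rw [map_mul, map_mul, map_inv, mul_inv_cancel_comm]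

/-- `χ(d(y m y⁻¹)) = χ(d(m))` for any function `χ` of the values of a homomorphism into a commutative group. [cite: BernsteinZelevinsky1977, §2.1] -/
theorem comp_map_conj_eq_of_commGroup {X : Sort*} (χ : T → X) (d : M →* T) (y m : M) :
    χ (d (y * m * y⁻¹)) = χ (d m) := by
  rw [map_conj_eq_of_commGroup]

end ConjHom

/-! ## §3 The Levi readings: `det K_m`, the intrinsic blocks, the model blocks -/

section Levi

variable (F : Type*) [Field F] [ValuativeRel F] [TopologicalSpace F] [IsNonarchimedeanLocalField F]
  {n : Type*} [Fintype n] [DecidableEq n] (c : n → Bool)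

omit [ValuativeRel F] [TopologicalSpace F] [IsNonarchimedeanLocalField F] in
/-- Bookkeeping: the inclusion `M_c ↪ P_c`, `m ↦ ⟨↑m, standardLeviGL_le F c m.2⟩`, takes `y m y⁻¹` to `ŷ m̂ ŷ⁻¹`. [cite: BernsteinZelevinsky1977, §2.1] -/
theorem inclusion_levi_conj (y m : ↥(standardLeviGL F c)) :
    (⟨((y * m * y⁻¹ : ↥(standardLeviGL F c)) : GL n F), standardLeviGL_le F c (y * m * y⁻¹).2⟩ : ↥(standardParabolicGL F c)) =
      (⟨(y : GL n F), standardLeviGL_le F c y.2⟩ : ↥(standardParabolicGL F c)) * ⟨(m : GL n F), standardLeviGL_le F c m.2⟩ *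
        (⟨(y : GL n F), standardLeviGL_le F c y.2⟩ : ↥(standardParabolicGL F c))⁻¹ :=
  Subtype.ext rfl

/-- **`det K_{y m y⁻¹} = det K_m` for `y, m ∈ M_c`** (box read in `P_c`; ★ `det_boxAd_conj_eq`): the modulus part of the transfer weight
is a class function of `M_c`. [cite: Rogawski1990, §4.13 Lemma 4.13.1 (a) p. 64] [cite: BernsteinZelevinsky1977, §2.3] -/
theorem det_boxAd_levi_conj_eq (y m : ↥(standardLeviGL F c)) :
    (Matrix.of fun q q' : {i : n // c i = false} × {j : n // c j = true} =>
        (((⟨((y * m * y⁻¹ : ↥(standardLeviGL F c)) : GL n F), standardLeviGL_le F c (y * m * y⁻¹).2⟩ :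
            ↥(standardParabolicGL F c)) : GL n F) : Matrix n n F) q.1 q'.1 *
          ((((⟨((y * m * y⁻¹ : ↥(standardLeviGL F c)) : GL n F), standardLeviGL_le F c (y * m * y⁻¹).2⟩ :
            ↥(standardParabolicGL F c))⁻¹ : standardParabolicGL F c) : GL n F) : Matrix n n F) q'.2 q.2).det =
      (Matrix.of fun q q' : {i : n // c i = false} × {j : n // c j = true} =>
        (((⟨(m : GL n F), standardLeviGL_le F c m.2⟩ : ↥(standardParabolicGL F c)) : GL n F) : Matrix n n F) q.1 q'.1 *
          ((((⟨(m : GL n F), standardLeviGL_le F c m.2⟩ : ↥(standardParabolicGL F c))⁻¹ : standardParabolicGL F c) : GL n F) :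
            Matrix n n F) q'.2 q.2).det := by
  rw [inclusion_levi_conj F c y m]
  exact det_boxAd_conj_eq _ _

/-- **`‖det K_{y m y⁻¹}‖_F = ‖det K_m‖_F`** for `y, m ∈ M_c` (the `normAbs` reading of `det_boxAd_levi_conj_eq`).
[cite: Rogawski1990, §4.13 Lemma 4.13.1 (a) p. 64] -/
theorem normAbs_det_boxAd_levi_conj_eq (y m : ↥(standardLeviGL F c)) :
    normAbs F (Matrix.of fun q q' : {i : n // c i = false} × {j : n // c j = true} =>
        (((⟨((y * m * y⁻¹ : ↥(standardLeviGL F c)) : GL n F), standardLeviGL_le F c (y * m * y⁻¹).2⟩ :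
            ↥(standardParabolicGL F c)) : GL n F) : Matrix n n F) q.1 q'.1 *
          ((((⟨((y * m * y⁻¹ : ↥(standardLeviGL F c)) : GL n F), standardLeviGL_le F c (y * m * y⁻¹).2⟩ :
            ↥(standardParabolicGL F c))⁻¹ : standardParabolicGL F c) : GL n F) : Matrix n n F) q'.2 q.2).det =
      normAbs F (Matrix.of fun q q' : {i : n // c i = false} × {j : n // c j = true} =>
        (((⟨(m : GL n F), standardLeviGL_le F c m.2⟩ : ↥(standardParabolicGL F c)) : GL n F) : Matrix n n F) q.1 q'.1 *
          ((((⟨(m : GL n F), standardLeviGL_le F c m.2⟩ : ↥(standardParabolicGL F c))⁻¹ : standardParabolicGL F c) : GL n F) :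
            Matrix n n F) q'.2 q.2).det := by
  rw [det_boxAd_levi_conj_eq F c y m]

omit [ValuativeRel F] [TopologicalSpace F] [IsNonarchimedeanLocalField F] in
/-- **The determinant of an intrinsic diagonal block is a class function of `M_c`**: `det((y m y⁻¹)_b) = det(m_b)` for the block
`m_b = leviProjection F c ⟨↑m, _⟩ b` (`det ∘ (· b) ∘ leviProjection ∘ (M_c ↪ P_c)` is a homomorphism into the commutative group `Fˣ`).
[cite: Rogawski1990, §4.9 p. 55] [cite: BernsteinZelevinsky1977, §2.1] -/
theorem det_leviProjection_levi_conj_eq (y m : ↥(standardLeviGL F c)) (b : Bool) :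
    Matrix.GeneralLinearGroup.det (leviProjection F c
        ⟨((y * m * y⁻¹ : ↥(standardLeviGL F c)) : GL n F), standardLeviGL_le F c (y * m * y⁻¹).2⟩ b) =
      Matrix.GeneralLinearGroup.det (leviProjection F c ⟨(m : GL n F), standardLeviGL_le F c m.2⟩ b) := by
  rw [inclusion_levi_conj F c y m]
  simp only [map_mul, map_inv, Pi.mul_apply, Pi.inv_apply, mul_inv_cancel_comm]

/-- `m ↦ det(m_b)` is continuous on `M_c` (`m_b = leviProjection F c ⟨↑m, _⟩ b`; ★ `continuous_leviProjection`, Mathlib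
`Matrix.GeneralLinearGroup.continuous_det`). [cite: BernsteinZelevinsky1977, §2.1] -/
theorem continuous_det_leviProjection_levi (b : Bool) :
    Continuous fun m : ↥(standardLeviGL F c) =>
      Matrix.GeneralLinearGroup.det (leviProjection F c ⟨(m : GL n F), standardLeviGL_le F c m.2⟩ b) := by
  haveI : IsTopologicalRing F := inferInstance
  exact Matrix.GeneralLinearGroup.continuous_det.comp
    ((continuous_apply b).comp ((continuous_leviProjection F c).comp (continuous_standardLeviGL_inclusion F c)))

/-- **`m ↦ χ(det m_b)` is locally constant on `M_c`** for `χ : Fˣ → X` locally constant (e.g. `χ = μ_w`, §1). [cite: Rogawski1990, §4.9 p. 55] [cite: BushnellHenniart2006, §1.1] -/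
theorem isLocallyConstant_comp_det_leviProjection_levi {X : Type*} {χ : Fˣ → X} (hχ : IsLocallyConstant χ) (b : Bool) :
    IsLocallyConstant fun m : ↥(standardLeviGL F c) =>
      χ (Matrix.GeneralLinearGroup.det (leviProjection F c ⟨(m : GL n F), standardLeviGL_le F c m.2⟩ b)) :=
  hχ.comp_continuous (continuous_det_leviProjection_levi F c b)

omit [ValuativeRel F] [TopologicalSpace F] [IsNonarchimedeanLocalField F] in
/-- **The determinant of a MODEL block is a class function of `M_c`**: for ANY group isomorphism `e : GL_k(F) × GL_l(F) ≃* M_c` (★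
`exists_continuousMulEquiv_prod_standardLeviGL_twoBlock` gives one with `↑(e x) = reindexGL finSumFinEquiv (blockDiagGL x)`),
`det (e⁻¹(y m y⁻¹)).1 = det (e⁻¹ m).1`. [cite: Rogawski1990, §4.9 p. 55] [cite: BernsteinZelevinsky1977, §2.1] -/
theorem det_fst_symm_conj_eq {k l : Type*} [Fintype k] [DecidableEq k] [Fintype l] [DecidableEq l]
    (e : (GL k F × GL l F) ≃* ↥(standardLeviGL F c)) (y m : ↥(standardLeviGL F c)) :
    Matrix.GeneralLinearGroup.det (e.symm (y * m * y⁻¹)).1 = Matrix.GeneralLinearGroup.det (e.symm m).1 := by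
  simp only [map_mul, map_inv, Prod.fst_mul, Prod.fst_inv, mul_inv_cancel_comm]

omit [ValuativeRel F] [TopologicalSpace F] [IsNonarchimedeanLocalField F] in
/-- The same for the second model block: `det (e⁻¹(y m y⁻¹)).2 = det (e⁻¹ m).2`. [cite: BernsteinZelevinsky1977, §2.1] -/
theorem det_snd_symm_conj_eq {k l : Type*} [Fintype k] [DecidableEq k] [Fintype l] [DecidableEq l]
    (e : (GL k F × GL l F) ≃* ↥(standardLeviGL F c)) (y m : ↥(standardLeviGL F c)) :
    Matrix.GeneralLinearGroup.det (e.symm (y * m * y⁻¹)).2 = Matrix.GeneralLinearGroup.det (e.symm m).2 := by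
  simp only [map_mul, map_inv, Prod.snd_mul, Prod.snd_inv, mul_inv_cancel_comm]

/-- **`m ↦ χ(det (e⁻¹ m).1)` is locally constant on `M_c`** for a TOPOLOGICAL group isomorphism `e : GL_k(F) × GL_l(F) ≃ₜ* M_c` and
`χ : Fˣ → X` locally constant. [cite: Rogawski1990, §4.9 p. 55] [cite: BushnellHenniart2006, §1.1] -/
theorem isLocallyConstant_comp_det_fst_symm {k l : Type*} [Fintype k] [DecidableEq k] [Fintype l]
    [DecidableEq l] (e : (GL k F × GL l F) ≃ₜ* ↥(standardLeviGL F c)) {X : Type*} {χ : Fˣ → X} (hχ : IsLocallyConstant χ) :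
    IsLocallyConstant fun m : ↥(standardLeviGL F c) => χ (Matrix.GeneralLinearGroup.det (e.symm m).1) := by
  haveI : IsTopologicalRing F := inferInstance
  exact hχ.comp_continuous (Matrix.GeneralLinearGroup.continuous_det.comp (continuous_fst.comp e.symm.continuous))

omit [ValuativeRel F] [TopologicalSpace F] [IsNonarchimedeanLocalField F] in
/-- **Junction with the block-family currency**: for `m ∈ M_c`, the element `⟨↑m, _⟩ ∈ P_c` IS `leviEmbeddingP F c` of its family of
diagonal blocks `leviProjection F c ⟨↑m, _⟩` — so the box `K_p` of ★ `finExplicitDelta_mul_toReal_eq_of_split` at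
`p := leviEmbeddingP F c (leviProjection F c ⟨↑m, _⟩)` is literally `K_m`. [cite: BernsteinZelevinsky1977, §2.1] -/
theorem leviEmbeddingP_leviProjection_levi (m : ↥(standardLeviGL F c)) :
    leviEmbeddingP F c (leviProjection F c ⟨(m : GL n F), standardLeviGL_le F c m.2⟩) =
      ⟨(m : GL n F), standardLeviGL_le F c m.2⟩ := by
  obtain ⟨m', hm'⟩ := m.2
  have h : (⟨(m : GL n F), standardLeviGL_le F c m.2⟩ : ↥(standardParabolicGL F c)) = leviEmbeddingP F c m' :=
    Subtype.ext hm'.symm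
  rw [h, leviProjection_leviEmbeddingP_apply]

end Levi

/-! ## §4 The heads: `ψ(m) = C · χ(m) · ‖det K_m‖^{1∕2}` is a locally constant class function of `M_c` -/

section Weight

variable (F : Type*) [Field F] [ValuativeRel F] [TopologicalSpace F] [IsNonarchimedeanLocalField F]
  {n : Type*} [Fintype n] [DecidableEq n] (c : n → Bool)

/-- **`ψ` IS A CLASS FUNCTION at `m₀`** — the `hψ` of ★ B5-L `classOrbitalIntegral_eq_mul_orbitalIntegral_of_isCanonical_of_eq`: for
`ψ m := C * χM m * ↑(√‖det K_m‖_F)` with `χM (y m₀ y⁻¹) = χM m₀` for all `y ∈ M_c`, `ψ (y m₀ y⁻¹) = ψ m₀` for all `y ∈ M_c`.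
[cite: Rogawski1990, §4.9 p. 55; §4.13 Lemma 4.13.1 (a) p. 64] -/
theorem levi_weight_conj_eq {χM : ↥(standardLeviGL F c) → ℂ} {m₀ : ↥(standardLeviGL F c)}
    (hχ : ∀ y : ↥(standardLeviGL F c), χM (y * m₀ * y⁻¹) = χM m₀) (C : ℂ) (y : ↥(standardLeviGL F c)) :
    C * χM (y * m₀ * y⁻¹) *
        ((Real.sqrt ((normAbs F (Matrix.of fun q q' : {i : n // c i = false} × {j : n // c j = true} =>
          (((⟨((y * m₀ * y⁻¹ : ↥(standardLeviGL F c)) : GL n F), standardLeviGL_le F c (y * m₀ * y⁻¹).2⟩ :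
              ↥(standardParabolicGL F c)) : GL n F) : Matrix n n F) q.1 q'.1 *
            ((((⟨((y * m₀ * y⁻¹ : ↥(standardLeviGL F c)) : GL n F), standardLeviGL_le F c (y * m₀ * y⁻¹).2⟩ :
              ↥(standardParabolicGL F c))⁻¹ : standardParabolicGL F c) : GL n F) : Matrix n n F) q'.2 q.2).det : ℝ≥0) : ℝ) : ℝ) : ℂ) =
      C * χM m₀ *
        ((Real.sqrt ((normAbs F (Matrix.of fun q q' : {i : n // c i = false} × {j : n // c j = true} =>
          (((⟨(m₀ : GL n F), standardLeviGL_le F c m₀.2⟩ : ↥(standardParabolicGL F c)) : GL n F) : Matrix n n F) q.1 q'.1 *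
            ((((⟨(m₀ : GL n F), standardLeviGL_le F c m₀.2⟩ : ↥(standardParabolicGL F c))⁻¹ : standardParabolicGL F c) : GL n F) :
              Matrix n n F) q'.2 q.2).det : ℝ≥0) : ℝ) : ℝ) : ℂ) := by
  rw [hχ y, normAbs_det_boxAd_levi_conj_eq F c y m₀]

/-- **`ψ` IS LOCALLY CONSTANT** — the `hψ` of ★ (A1) `isLocSmooth_mul_constantTerm_comp_twoOne`: for `χM : M_c → ℂ` locally constant,
`m ↦ C * χM m * ↑(√‖det K_m‖_F)` is locally constant on `M_c` (★ `isLocallyConstant_normAbs_det_boxAd_levi`).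
[cite: Rogawski1990, §4.13 Lemma 4.13.1 (a) p. 64; §4.9 Prop. 4.9.1 (a) p. 55] -/
theorem isLocallyConstant_levi_weight {χM : ↥(standardLeviGL F c) → ℂ} (hχ : IsLocallyConstant χM) (C : ℂ) :
    IsLocallyConstant fun m : ↥(standardLeviGL F c) => C * χM m *
      ((Real.sqrt ((normAbs F (Matrix.of fun q q' : {i : n // c i = false} × {j : n // c j = true} =>
        (((⟨(m : GL n F), standardLeviGL_le F c m.2⟩ : ↥(standardParabolicGL F c)) : GL n F) : Matrix n n F) q.1 q'.1 *
          ((((⟨(m : GL n F), standardLeviGL_le F c m.2⟩ : ↥(standardParabolicGL F c))⁻¹ : standardParabolicGL F c) : GL n F) :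
            Matrix n n F) q'.2 q.2).det : ℝ≥0) : ℝ) : ℝ) : ℂ) :=
  ((IsLocallyConstant.const C).mul hχ).mul
    ((isLocallyConstant_normAbs_det_boxAd_levi F c).comp fun r : ℝ≥0 => ((Real.sqrt (r : ℝ) : ℝ) : ℂ))

/-- **The weight through an intrinsic block, class function**: `ψ m := C * χ (det m_{b₀}) * ↑(√‖det K_m‖_F)` (`m_{b₀} = leviProjection F c ⟨↑m, _⟩ b₀`;
at the `(2,1)` Levi, `b₀ = false` is the `GL₂`-block and `χ = μ_w` gives Rogawski's `τ δ_P^{1∕2}` up to `C`) satisfies `ψ (y m₀ y⁻¹) = ψ m₀`.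
[cite: Rogawski1990, §4.9 p. 55; §4.13 Lemma 4.13.1 (a) p. 64] -/
theorem levi_weight_det_leviProjection_conj_eq (χ : Fˣ → ℂ) (b₀ : Bool) (C : ℂ) (m₀ y : ↥(standardLeviGL F c)) :
    C * χ (Matrix.GeneralLinearGroup.det (leviProjection F c
          ⟨((y * m₀ * y⁻¹ : ↥(standardLeviGL F c)) : GL n F), standardLeviGL_le F c (y * m₀ * y⁻¹).2⟩ b₀)) *
        ((Real.sqrt ((normAbs F (Matrix.of fun q q' : {i : n // c i = false} × {j : n // c j = true} =>
          (((⟨((y * m₀ * y⁻¹ : ↥(standardLeviGL F c)) : GL n F), standardLeviGL_le F c (y * m₀ * y⁻¹).2⟩ :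
              ↥(standardParabolicGL F c)) : GL n F) : Matrix n n F) q.1 q'.1 *
            ((((⟨((y * m₀ * y⁻¹ : ↥(standardLeviGL F c)) : GL n F), standardLeviGL_le F c (y * m₀ * y⁻¹).2⟩ :
              ↥(standardParabolicGL F c))⁻¹ : standardParabolicGL F c) : GL n F) : Matrix n n F) q'.2 q.2).det : ℝ≥0) : ℝ) : ℝ) : ℂ) =
      C * χ (Matrix.GeneralLinearGroup.det (leviProjection F c ⟨(m₀ : GL n F), standardLeviGL_le F c m₀.2⟩ b₀)) *
        ((Real.sqrt ((normAbs F (Matrix.of fun q q' : {i : n // c i = false} × {j : n // c j = true} =>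
          (((⟨(m₀ : GL n F), standardLeviGL_le F c m₀.2⟩ : ↥(standardParabolicGL F c)) : GL n F) : Matrix n n F) q.1 q'.1 *
            ((((⟨(m₀ : GL n F), standardLeviGL_le F c m₀.2⟩ : ↥(standardParabolicGL F c))⁻¹ : standardParabolicGL F c) : GL n F) :
              Matrix n n F) q'.2 q.2).det : ℝ≥0) : ℝ) : ℝ) : ℂ) :=
  levi_weight_conj_eq F c (χM := fun m => χ (Matrix.GeneralLinearGroup.det
      (leviProjection F c ⟨(m : GL n F), standardLeviGL_le F c m.2⟩ b₀)))
    (fun y' => det_leviProjection_levi_conj_eq F c y' m₀ b₀ ▸ rfl) C y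

/-- **The weight through an intrinsic block, locally constant**: for `χ : Fˣ → ℂ` locally constant,
`m ↦ C * χ (det m_{b₀}) * ↑(√‖det K_m‖_F)` is locally constant on `M_c`. [cite: Rogawski1990, §4.13 Lemma 4.13.1 (a) p. 64; §4.9 p. 55] -/
theorem isLocallyConstant_levi_weight_det_leviProjection {χ : Fˣ → ℂ} (hχ : IsLocallyConstant χ) (b₀ : Bool) (C : ℂ) :
    IsLocallyConstant fun m : ↥(standardLeviGL F c) =>
      C * χ (Matrix.GeneralLinearGroup.det (leviProjection F c ⟨(m : GL n F), standardLeviGL_le F c m.2⟩ b₀)) *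
        ((Real.sqrt ((normAbs F (Matrix.of fun q q' : {i : n // c i = false} × {j : n // c j = true} =>
          (((⟨(m : GL n F), standardLeviGL_le F c m.2⟩ : ↥(standardParabolicGL F c)) : GL n F) : Matrix n n F) q.1 q'.1 *
            ((((⟨(m : GL n F), standardLeviGL_le F c m.2⟩ : ↥(standardParabolicGL F c))⁻¹ : standardParabolicGL F c) : GL n F) :
              Matrix n n F) q'.2 q.2).det : ℝ≥0) : ℝ) : ℝ) : ℂ) :=
  isLocallyConstant_levi_weight F c (isLocallyConstant_comp_det_leviProjection_levi F c hχ b₀) C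

/-- **The weight through a MODEL block, class function**: for any group isomorphism `e : GL_k(F) × GL_l(F) ≃* M_c`,
`ψ m := C * χ (det (e⁻¹ m).1) * ↑(√‖det K_m‖_F)` satisfies `ψ (y m₀ y⁻¹) = ψ m₀` (at the split place: `e = e_M` of ★
`exists_continuousMulEquiv_prod_standardLeviGL_twoBlock`, `χ = μ_w`, so `ψ(j̃ γ_H) = C · μ_w(det g_w) · ‖det K‖^{1∕2}`).
[cite: Rogawski1990, §4.9 p. 55; §4.13 Lemma 4.13.1 (a) p. 64] -/
theorem levi_weight_det_fst_symm_conj_eq {k l : Type*} [Fintype k] [DecidableEq k] [Fintype l] [DecidableEq l]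
    (e : (GL k F × GL l F) ≃* ↥(standardLeviGL F c)) (χ : Fˣ → ℂ) (C : ℂ) (m₀ y : ↥(standardLeviGL F c)) :
    C * χ (Matrix.GeneralLinearGroup.det (e.symm (y * m₀ * y⁻¹)).1) *
        ((Real.sqrt ((normAbs F (Matrix.of fun q q' : {i : n // c i = false} × {j : n // c j = true} =>
          (((⟨((y * m₀ * y⁻¹ : ↥(standardLeviGL F c)) : GL n F), standardLeviGL_le F c (y * m₀ * y⁻¹).2⟩ :
              ↥(standardParabolicGL F c)) : GL n F) : Matrix n n F) q.1 q'.1 *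
            ((((⟨((y * m₀ * y⁻¹ : ↥(standardLeviGL F c)) : GL n F), standardLeviGL_le F c (y * m₀ * y⁻¹).2⟩ :
              ↥(standardParabolicGL F c))⁻¹ : standardParabolicGL F c) : GL n F) : Matrix n n F) q'.2 q.2).det : ℝ≥0) : ℝ) : ℝ) : ℂ) =
      C * χ (Matrix.GeneralLinearGroup.det (e.symm m₀).1) *
        ((Real.sqrt ((normAbs F (Matrix.of fun q q' : {i : n // c i = false} × {j : n // c j = true} =>
          (((⟨(m₀ : GL n F), standardLeviGL_le F c m₀.2⟩ : ↥(standardParabolicGL F c)) : GL n F) : Matrix n n F) q.1 q'.1 *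
            ((((⟨(m₀ : GL n F), standardLeviGL_le F c m₀.2⟩ : ↥(standardParabolicGL F c))⁻¹ : standardParabolicGL F c) : GL n F) :
              Matrix n n F) q'.2 q.2).det : ℝ≥0) : ℝ) : ℝ) : ℂ) :=
  levi_weight_conj_eq F c (χM := fun m => χ (Matrix.GeneralLinearGroup.det (e.symm m).1))
    (fun y' => by rw [det_fst_symm_conj_eq F c e y' m₀]) C y

/-- **The weight through a MODEL block, locally constant**: for a topological group isomorphism `e : GL_k(F) × GL_l(F) ≃ₜ* M_c` and
`χ : Fˣ → ℂ` locally constant, `m ↦ C * χ (det (e⁻¹ m).1) * ↑(√‖det K_m‖_F)` is locally constant on `M_c`.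
[cite: Rogawski1990, §4.13 Lemma 4.13.1 (a) p. 64; §4.9 p. 55] -/
theorem isLocallyConstant_levi_weight_det_fst_symm {k l : Type*} [Fintype k] [DecidableEq k] [Fintype l] [DecidableEq l]
    (e : (GL k F × GL l F) ≃ₜ* ↥(standardLeviGL F c)) {χ : Fˣ → ℂ} (hχ : IsLocallyConstant χ) (C : ℂ) :
    IsLocallyConstant fun m : ↥(standardLeviGL F c) =>
      C * χ (Matrix.GeneralLinearGroup.det (e.symm m).1) *
        ((Real.sqrt ((normAbs F (Matrix.of fun q q' : {i : n // c i = false} × {j : n // c j = true} =>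
          (((⟨(m : GL n F), standardLeviGL_le F c m.2⟩ : ↥(standardParabolicGL F c)) : GL n F) : Matrix n n F) q.1 q'.1 *
            ((((⟨(m : GL n F), standardLeviGL_le F c m.2⟩ : ↥(standardParabolicGL F c))⁻¹ : standardParabolicGL F c) : GL n F) :
              Matrix n n F) q'.2 q.2).det : ℝ≥0) : ℝ) : ℝ) : ℂ) :=
  isLocallyConstant_levi_weight F c (isLocallyConstant_comp_det_fst_symm F c e hχ) C

end Weight

end Literature.NumberTheory.Automorphic

end
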